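import Summits.BirchSwinnertonDyer.Rank1Residual.GaloisImage.LocalTorsionAwayFromPAdicCompletion
import Summits.BirchSwinnertonDyer.Rank1Residual.GaloisImage.VisibleLowerBoundThree
import Summits.BirchSwinnertonDyer.Rank1Residual.GaloisImage.PadicTwistClassDecider
import Summits.BirchSwinnertonDyer.Rank1Residual.Additive.X4RankZeroVisibleLowerBoundPrimeList
import Summits.BirchSwinnertonDyer.Rank1Residual.Additive.IntModelTamagawaCertificateLocal
import Summits.BirchSwinnertonDyer.Rank1Residual.X11b.VisibilityPrimeList
import Summits.BirchSwinnertonDyer.Rank1Residual.X11b.ChaPairsMinimality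
import Summits.BirchSwinnertonDyer.Rank1Residual.X10.CasselsTatePairingRecordsB
import Summits.BirchSwinnertonDyer.Rank1Residual.X10.SelfTwistVisibleRecord322624k
import Summits.BirchSwinnertonDyer.Rank1Residual.X10.CMPartnerMinimality
import Summits.BirchSwinnertonDyer.BirchSwinnertonDyer.Theorems.Rank1ResidualIntModelReduction
import Literature.NumberTheory.EllipticCurves.MazurRubin2015.KummerImageGoodReduction
import Literature.NumberTheory.EllipticCurves.CongruenceVisibilityMultiplicativeTwisted
import Literature.NumberTheory.EllipticCurves.SelmerCorankControlRatProofs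
import HarnessLib

/-!
# N2 (X10b @ 3): the SELF-TWIST visible lower bound with the place `3` FREE of kind (v)
# (Mazur–Rubin 2015) — the socket for the ANOMALOUS self-twist pairs, and the record `55696l1`
# (cell `b2b-bsdres`, unit `b2b-bsdres-x10` = N2 class lead, GEN 22; per-pair RECORDS, close nothing)

HONEST FRAMING (cell `b2b-bsdres`, run/shared/lean/b2b/bsd-rank1-residual/, verbatim in every
file): the goal of the cell is to DELETE the COMBINATION-SHAPED residual classes of the
Birch–Swinnerton-Dyer formula for ALL analytic-rank `≤ 1` elliptic curves over `ℚ` — "full BSD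
formula for every rank `≤ 1` curve in class `C`" assembled STRICTLY from published theorems — so
that the rank-`≤ 1` remainder becomes exactly the CONSTRUCTION-SHAPED classes, which are TYPED
(missing-input `Prop`s), NOT attempted. This is not "finishing BSD". Class X10b (= N2) stays
CONSTRUCTION-SHAPED (NEEDS `X_A3`); this file is a TOOL plus PER-PAIR RECORDS of the LOWER half only;
nothing is booked; no mark / label / tier / count is changed. Theorems only (no definition, no named
fact of ours, no `sorry`).

## What

The N2 self-twist law (x10 GEN 21, `HOME/b2b-bsdres-x10/g21/selftwist/SELF-TWIST-LAW.md`; records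
`X10/SelfTwistVisibleRecord322624k.lean` p346392, `…305762d.lean` p347883): a `3Ns` curve `E` and its
quadratic twist `E′ = E ⊗ χ_{d*}` by the dihedral field `M = ℚ(√d*)` have `E′[3] ≅ E[3]`; nine rank-`0`
Ш-cells of N2 have no discrepancy place and a twin of Mordell–Weil rank `2`.  The tree's visibility
count PAYS the place `3` at the price `#E′(ℚ₃)[3] · #(ℤ₃/3)`; since `3` SPLITS in `M` (`d* ≡ 1 (3)`),
`a₃(E′) = a₃(E)`, and for the SEVEN cells `40898d 55696l 55696n 110224f 183184b 327184dt 395641f` both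
curves are ANOMALOUS at `3` (`a₃ ≡ 1 (3)`, `#E′(ℚ₃)[3] = 3`: n1011-p17's decider returns `S = 1`), so the
price is `9 = 3^{rank E′}` and the count does not close (x10 GEN 21 `class-closure/N2/KIND-VIII-SPEC-x10g21.md`).
THIS FILE makes the place `3` FREE instead, by the FIFTH kind of x10b GEN 15
(`Literature/…/MazurRubin2015/KummerImageGoodReduction.lean`): at the place of `p` where BOTH curves
have GOOD reduction (`e = 1 < p − 1`) the local Kummer conditions agree along `θ` — Mazur–Rubin,
*Selmer companion curves*, Trans. AMS 367 (2015) Thm. 3.1 (iv)(b) with §5.3 / §6 Case 5 (Raynaud),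
the tree's NAMED FACT `selmerLocalKer_iff_of_goodReduction_above` (binder `hMR`, DISPLAYED, not
proved in the tree).  With `3` free the count needs only `rank E′ ≥ 1` (`1 < 3`).

* §1 TOOL `exists_sha_ne_zero_three_of_congr_goodAtThree_of_primeList` — the visibility count over
  `ℚ` at `p = 3` for integer models `E₀`, `F₀` with discriminants supported on a prime list `L ∋ 3`,
  `3 ∤ Δ(E₀) Δ(F₀)` (both GOOD at `3`: kind (v), `hMR`), every other listed place of kind (i)
  (`#E′(ℚ_ℓ)[3] = 1`), `E(ℚ)` finite of order prime to `3`, `rank E′(ℚ) ≥ 1` ⇒ `Ш(E)[3] ≠ 0`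
  (hook `WeierstrassCurve.exists_sha_ne_zero_of_congr_of_le_off` with `T = ∅`); and
  `…_goodAtThree_mult_of_primeList`, the same with places of kind (iii) allowed (both curves
  multiplicative of the same twist class, `μ₃(ℚ_ℓ) = 1`; Tate uniformisation `hU2`) — for `40898d`.
* §2 RECORD `55696l1` / twin `55696m1` (`N = 55696 = 2⁴·59²`, `d* = −59`, twin additive at `2` (Kodaira
  `I*ₙ`) and at `59` (type `III`, `c = 2`); `L = [2, 3, 59]`): `∃ c ∈ Ш(E), c ≠ 0, 3c = 0`; `3² ∣ #Ш(E)[3^∞]`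
  (`hCT`); the typed LOWER binder `MissingLowerBoundAt W 3` (`#Ш_an = 9`).  Every local binder IN THE KERNEL
  (TamLocal certificates emitted by n1011-p18's glue `g11/tools/vis3_certs.py` UNCHANGED, re-decided here;
  the twin's minimality by x10 GEN 18's pattern F2d); `E[3]` irreducible from the Frobenius witness `ℓ = 13`
  over x10 GEN 12's landed point count `X10.card_t55696l1_13`.  The other six cells follow in
  `SelfTwistVisibleGoodAtThreeRecords{A,B,C}.lean`.
BINDERS LEFT (displayed, EVIDENCE columns — nothing booked): `hMR` (Mazur–Rubin 2015), `hCT`, `hGZK`,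
`hr : r_an(E) = 0` (Cremona), `θ : E′[3] ≃ E[3]` with `hθ` (the self-twist congruence; EVIDENCE: cc-eng-2
KO-certified `class-closure/N2/CONG-certified-eng2.tsv` row 55696l/55696m (bound 14 159, 1 665 primes), kit j123296),
`hrank : 1 ≤ rank E′(ℚ)` (Cremona: rank `2`), `hq : #Ш_an = 9`.

References: [MazurRubin2015SelmerCompanions] Thm. 3.1 (iv)(b), §5.3, §6 Case 5; [CremonaMazur2000] §3;
[AgasheStein2002] Thm. 3.1; [Mazur1978] Prop. 6.3 (1); [SilvermanATAEC1994] IV.9.4, V.5.3–5.4;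
[SilvermanAEC2009] VII.5.1, X.4.14; [Cremona2006] Table 1 (labels 55696l1, 55696m1, 55696n1, 55696o1).
-/

set_option autoImplicit false

noncomputable section

open scoped Classical NumberField
open IsDedekindDomain NumberField WeierstrassCurve Rat.HeightOneSpectrum
  Literature.NumberTheory.EllipticCurves Literature.NumberTheory.EllipticCurves.ModularForms
  Literature.NumberTheory.EllipticCurves.Rank1Residual
  Literature.NumberTheory.EllipticCurves.Rank1Residual.Typed
  Literature.NumberTheory.EllipticCurves.MazurRubin2015
  Literature.NumberTheory.GaloisRepresentations
  Summit.BirchSwinnertonDyer.BirchSwinnertonDyer.Rank1Residual.IntModel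
  Summit.BirchSwinnertonDyer.BirchSwinnertonDyer.Rank1Residual.X11RankOne
  Summit.BirchSwinnertonDyer.BirchSwinnertonDyer.Rank2Observatory
  Summit.BirchSwinnertonDyer.BirchSwinnertonDyer.Rank2Observatory.Tam
  Summit.BirchSwinnertonDyer.Rank1Residual.GaloisImage
  Summit.BirchSwinnertonDyer.Rank1Residual.GaloisImage.LocalTorsion3At
  Summit.BirchSwinnertonDyer.Rank1Residual.Additive
  Summit.BirchSwinnertonDyer.Rank1Residual.X11b

namespace Summit.BirchSwinnertonDyer.Rank1Residual.X10.SelfTwist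

/-! ### §1. The socket: visibility over `ℚ` at `p = 3` with the place `3` FREE of kind (v) -/

/-- **Visible `Ш(E)[3] ≠ 0` from a `3`-congruent partner, the place `3` FREE (both curves GOOD at `3`,
Mazur–Rubin 2015 kind (v)), every other bad place of kind (i).**  `E = W = E₀ ⊗ ℚ`, `E′ = W′ = F₀ ⊗ ℚ`
with `Δ(E₀)`, `Δ(F₀)` supported on the prime list `L ∋ 3` and `3 ∤ Δ(E₀)`, `3 ∤ Δ(F₀)`; `θ : E′[3] ⥲ E[3]`
`Γ_ℚ`-equivariant; `E(ℚ)` finite of order prime to `3`; `rank E′(ℚ) ≥ 1`; at every place over `ℓ ∈ L`,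
`ℓ ≠ 3`: `#E′(ℚ_ℓ)[3] = 1`.  Then `∃ c ∈ Ш(E/ℚ)`, `c ≠ 0`, `3c = 0`.  Proof: the hook
`exists_sha_ne_zero_of_congr_of_le_off` with `S` = places over `L`, `T = ∅`: agreement at `3` is the named
fact `hMR` (`selmerLocalKer_iff_of_goodReduction_above_rat`), at `ℓ ≠ 3` it is
`relIndex_map_selmerLocalKer_eq_one_of_card_torsion_eq_one`; `[E(ℚ):3E(ℚ)] = 1 < 3 ≤ [E′(ℚ):3E′(ℚ)]`.
Conditional on `hMR`. [cite: MazurRubin2015SelmerCompanions, Thm. 3.1 (iv)(b) and §6 proof Case 5]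
[cite: CremonaMazur2000, §3 and Table 1] [cite: AgasheStein2002, Thm. 3.1 and §3.5] -/
theorem exists_sha_ne_zero_three_of_congr_goodAtThree_of_primeList
    (hMR : selmerLocalKer_iff_of_goodReduction_above)
    (W W' : WeierstrassCurve ℚ) [W.IsElliptic] [W'.IsElliptic]
    (θ : geomTorsion W' ((3 : ℕ) : ℤ) ≃+ geomTorsion W ((3 : ℕ) : ℤ))
    (hθ : ∀ (σ : Field.absoluteGaloisGroup ℚ) (P : geomTorsion W' ((3 : ℕ) : ℤ)), θ (σ • P) = σ • θ P)
    {E₀ F₀ : WeierstrassCurve ℤ} (hE : E₀.map (Int.castRingHom ℚ) = W)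
    (hF : F₀.map (Int.castRingHom ℚ) = W') (L : List ℕ) (h3L : 3 ∈ L)
    (hΔE : ∀ q : ℕ, q.Prime → (q : ℤ) ∣ E₀.Δ → q ∈ L)
    (hΔF : ∀ q : ℕ, q.Prime → (q : ℤ) ∣ F₀.Δ → q ∈ L)
    (h3E : ¬ ((3 : ℕ) : ℤ) ∣ E₀.Δ) (h3F : ¬ ((3 : ℕ) : ℤ) ∣ F₀.Δ)
    (hfin : Finite W.toAffine.Point) (hcop : (Nat.card W.toAffine.Point).Coprime 3)
    (hrank : 1 ≤ W'.mordellWeilRank)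
    (hplaces : ∀ v : HeightOneSpectrum (𝓞 ℚ), (primesEquiv v : ℕ) ∈ L → (primesEquiv v : ℕ) ≠ 3 →
      Nat.card (nsmulAddMonoidHom 3 :
        (W'.baseChange (v.adicCompletion ℚ)).toAffine.Point →+ _).ker = 1) :
    ∃ c : W.sha, c ≠ 0 ∧ 3 • c = 0 := by
  haveI : Fact (Nat.Prime 3) := ⟨Nat.prime_three⟩
  haveI := hfin
  set e := primesEquiv (R := 𝓞 ℚ) with he
  -- the finite set of places over `L`
  set S : Finset (HeightOneSpectrum (𝓞 ℚ)) :=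
    (L.filterMap fun q ↦ if h : q.Prime then some (e.symm ⟨q, h⟩) else none).toFinset with hSdef
  have hmemS : ∀ v : HeightOneSpectrum (𝓞 ℚ), v ∈ S ↔ (e v : ℕ) ∈ L := by
    intro v
    rw [hSdef, List.mem_toFinset, List.mem_filterMap]
    constructor
    · rintro ⟨q, hq, hqv⟩
      by_cases hqp : q.Prime
      · rw [dif_pos hqp, Option.some.injEq] at hqv
        rw [← hqv, Equiv.apply_symm_apply]
        exact hq
      · rw [dif_neg hqp] at hqv
        exact absurd hqv (by simp)
    · intro hv
      refine ⟨(e v : ℕ), hv, ?_⟩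
      rw [dif_pos (e v).2]
      simp
  refine exists_sha_ne_zero_of_congr_of_le_off W W' (by norm_num) θ hθ S ∅ (Finset.empty_subset S)
    (fun v hvS ↦ ?_) (fun v hvS _ c hc ↦ ?_) ?_
  · -- outside `S`: good reduction of both curves and `v ∤ 3`
    have hvL : (e v : ℕ) ∉ L := fun h ↦ hvS ((hmemS v).mpr h)
    have hq : (e v : ℕ).Prime := (e v).2
    refine ⟨?_, ?_, fun h3v ↦ hvL ?_⟩
    · rw [← hE]
      exact hasGoodReductionAt_map_of_not_dvd E₀ v fun h ↦ hvL (hΔE _ hq h)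
    · rw [← hF]
      exact hasGoodReductionAt_map_of_not_dvd F₀ v fun h ↦ hvL (hΔF _ hq h)
    · rw [he, Rat.HeightOneSpectrum.primesEquiv_eq_of_natCast_mem v Nat.prime_three h3v]
      exact h3L
  · -- on `S`: kind (v) at the place of `3`, kind (i) elsewhere
    have hvL : (e v : ℕ) ∈ L := (hmemS v).mp hvS
    by_cases hv3 : (e v : ℕ) = 3
    · have h3v : ((3 : ℕ) : 𝓞 ℚ) ∈ v.asIdeal := by
        rw [← hv3, he]
        exact Rat.HeightOneSpectrum.natCast_natGenerator_mem v
      have hgood : W.HasGoodReductionAt v := by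
        rw [← hE]
        exact hasGoodReductionAt_map_of_not_dvd E₀ v (by rw [← he, hv3]; exact h3E)
      have hgood' : W'.HasGoodReductionAt v := by
        rw [← hF]
        exact hasGoodReductionAt_map_of_not_dvd F₀ v (by rw [← he, hv3]; exact h3F)
      exact (selmerLocalKer_iff_of_goodReduction_above_rat hMR W W' (by norm_num) θ hθ v h3v hgood
        hgood' c).mp hc
    · have h3v : ((3 : ℕ) : 𝓞 ℚ) ∉ v.asIdeal := fun h ↦
        hv3 (Rat.HeightOneSpectrum.primesEquiv_eq_of_natCast_mem v Nat.prime_three h)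
      exact (relIndex_map_selmerLocalKer_eq_one_iff W W' θ hθ).mp
        (relIndex_map_selmerLocalKer_eq_one_of_card_torsion_eq_one W W' θ hθ h3v
          (hplaces v hvL hv3)) c hc
  · -- the count: `[E(ℚ):3E(ℚ)] · 1 = 1 < 3 ≤ 3 ^ rank E′ ≤ [E′(ℚ):3E′(ℚ)]`
    -- (the `AddCommGroup` structure on `E(ℚ)` in the hook carries the classical `DecidableEq ℚ`; `convert`)
    have h1 := index_range_zsmul_eq_one_of_coprime (p := 3) hcop
    have h2 := pow_mordellWeilRank_le_index_range_zsmul W' (n := 3) (by norm_num)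
    have h3 : (1 : ℕ) < 3 ^ W'.mordellWeilRank :=
      lt_of_lt_of_le (by norm_num) (Nat.pow_le_pow_right (by norm_num) hrank)
    rw [Finset.prod_empty, mul_one]
    refine lt_of_le_of_lt (le_of_eq ?_) (lt_of_lt_of_le h3 ?_)
    · convert h1
    · convert h2

/-- **The same socket with multiplicative places of kind (iii) allowed** (both curves multiplicative at
`v`, same twist class `γ(E) = r² γ(E′)` in `ℚ_v`, `γ = −c₄/c₆`, and `μ₃(ℚ_v) = 1`; agreement by the tree's
`h1Equiv_mem_selmerLocalKer_of_hasMultiplicativeReductionAt`, conditional on the Tate-uniformisation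
fact `hU2`).  Conditional on `hU2`, `hMR`. [cite: MazurRubin2015SelmerCompanions, Thm. 3.1 (iv)(b) and §6 proof Case 5]
[cite: SilvermanATAEC1994, Ch. V Thm. 5.3, Cor. 5.4] [cite: CremonaMazur2000, §3 and Table 1] -/
theorem exists_sha_ne_zero_three_of_congr_goodAtThree_mult_of_primeList
    (hU2 : Silverman1994_thmV53_corV54_tateUniformisation.{0})
    (hMR : selmerLocalKer_iff_of_goodReduction_above)
    (W W' : WeierstrassCurve ℚ) [W.IsElliptic] [W'.IsElliptic]
    (θ : geomTorsion W' ((3 : ℕ) : ℤ) ≃+ geomTorsion W ((3 : ℕ) : ℤ))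
    (hθ : ∀ (σ : Field.absoluteGaloisGroup ℚ) (P : geomTorsion W' ((3 : ℕ) : ℤ)), θ (σ • P) = σ • θ P)
    {E₀ F₀ : WeierstrassCurve ℤ} (hE : E₀.map (Int.castRingHom ℚ) = W)
    (hF : F₀.map (Int.castRingHom ℚ) = W') (L : List ℕ) (h3L : 3 ∈ L)
    (hΔE : ∀ q : ℕ, q.Prime → (q : ℤ) ∣ E₀.Δ → q ∈ L)
    (hΔF : ∀ q : ℕ, q.Prime → (q : ℤ) ∣ F₀.Δ → q ∈ L)
    (h3E : ¬ ((3 : ℕ) : ℤ) ∣ E₀.Δ) (h3F : ¬ ((3 : ℕ) : ℤ) ∣ F₀.Δ)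
    (hfin : Finite W.toAffine.Point) (hcop : (Nat.card W.toAffine.Point).Coprime 3)
    (hrank : 1 ≤ W'.mordellWeilRank)
    (hplaces : ∀ v : HeightOneSpectrum (𝓞 ℚ), (primesEquiv v : ℕ) ∈ L → (primesEquiv v : ℕ) ≠ 3 →
      Nat.card (nsmulAddMonoidHom 3 :
        (W'.baseChange (v.adicCompletion ℚ)).toAffine.Point →+ _).ker = 1 ∨
      (W.HasMultiplicativeReductionAt v ∧ W'.HasMultiplicativeReductionAt v ∧
        (∃ r : v.adicCompletion ℚ, algebraMap ℚ (v.adicCompletion ℚ) (-(W.c₄ / W.c₆)) =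
          r ^ 2 * algebraMap ℚ (v.adicCompletion ℚ) (-(W'.c₄ / W'.c₆))) ∧
        (∀ ζ : v.adicCompletion ℚ, ζ ^ 3 = 1 → ζ = 1))) :
    ∃ c : W.sha, c ≠ 0 ∧ 3 • c = 0 := by
  haveI : Fact (Nat.Prime 3) := ⟨Nat.prime_three⟩
  haveI := hfin
  set e := primesEquiv (R := 𝓞 ℚ) with he
  set S : Finset (HeightOneSpectrum (𝓞 ℚ)) :=
    (L.filterMap fun q ↦ if h : q.Prime then some (e.symm ⟨q, h⟩) else none).toFinset with hSdef
  have hmemS : ∀ v : HeightOneSpectrum (𝓞 ℚ), v ∈ S ↔ (e v : ℕ) ∈ L := by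
    intro v
    rw [hSdef, List.mem_toFinset, List.mem_filterMap]
    constructor
    · rintro ⟨q, hq, hqv⟩
      by_cases hqp : q.Prime
      · rw [dif_pos hqp, Option.some.injEq] at hqv
        rw [← hqv, Equiv.apply_symm_apply]
        exact hq
      · rw [dif_neg hqp] at hqv
        exact absurd hqv (by simp)
    · intro hv
      refine ⟨(e v : ℕ), hv, ?_⟩
      rw [dif_pos (e v).2]
      simp
  refine exists_sha_ne_zero_of_congr_of_le_off W W' (by norm_num) θ hθ S ∅ (Finset.empty_subset S)
    (fun v hvS ↦ ?_) (fun v hvS _ c hc ↦ ?_) ?_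
  · have hvL : (e v : ℕ) ∉ L := fun h ↦ hvS ((hmemS v).mpr h)
    have hq : (e v : ℕ).Prime := (e v).2
    refine ⟨?_, ?_, fun h3v ↦ hvL ?_⟩
    · rw [← hE]
      exact hasGoodReductionAt_map_of_not_dvd E₀ v fun h ↦ hvL (hΔE _ hq h)
    · rw [← hF]
      exact hasGoodReductionAt_map_of_not_dvd F₀ v fun h ↦ hvL (hΔF _ hq h)
    · rw [he, Rat.HeightOneSpectrum.primesEquiv_eq_of_natCast_mem v Nat.prime_three h3v]
      exact h3L
  · have hvL : (e v : ℕ) ∈ L := (hmemS v).mp hvS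
    by_cases hv3 : (e v : ℕ) = 3
    · have h3v : ((3 : ℕ) : 𝓞 ℚ) ∈ v.asIdeal := by
        rw [← hv3, he]
        exact Rat.HeightOneSpectrum.natCast_natGenerator_mem v
      have hgood : W.HasGoodReductionAt v := by
        rw [← hE]
        exact hasGoodReductionAt_map_of_not_dvd E₀ v (by rw [← he, hv3]; exact h3E)
      have hgood' : W'.HasGoodReductionAt v := by
        rw [← hF]
        exact hasGoodReductionAt_map_of_not_dvd F₀ v (by rw [← he, hv3]; exact h3F)
      exact (selmerLocalKer_iff_of_goodReduction_above_rat hMR W W' (by norm_num) θ hθ v h3v hgood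
        hgood' c).mp hc
    · have h3v : ((3 : ℕ) : 𝓞 ℚ) ∉ v.asIdeal := fun h ↦
        hv3 (Rat.HeightOneSpectrum.primesEquiv_eq_of_natCast_mem v Nat.prime_three h)
      rcases hplaces v hvL hv3 with hloc | ⟨hWv, hW'v, hγ, hμ⟩
      · exact (relIndex_map_selmerLocalKer_eq_one_iff W W' θ hθ).mp
          (relIndex_map_selmerLocalKer_eq_one_of_card_torsion_eq_one W W' θ hθ h3v hloc) c hc
      · exact W.h1Equiv_mem_selmerLocalKer_of_hasMultiplicativeReductionAt v hU2 (by norm_num) W' θ hθ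
          hWv hW'v hγ hμ hc
  · -- (the `AddCommGroup` structure on `E(ℚ)` in the hook carries the classical `DecidableEq ℚ`; `convert`)
    have h1 := index_range_zsmul_eq_one_of_coprime (p := 3) hcop
    have h2 := pow_mordellWeilRank_le_index_range_zsmul W' (n := 3) (by norm_num)
    have h3 : (1 : ℕ) < 3 ^ W'.mordellWeilRank :=
      lt_of_lt_of_le (by norm_num) (Nat.pow_le_pow_right (by norm_num) hrank)
    rw [Finset.prod_empty, mul_one]
    refine lt_of_le_of_lt (le_of_eq ?_) (lt_of_lt_of_le h3 ?_)
    · convert h1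
    · convert h2

/-! ### §2. Record -/

/-! ### Record `55696l1` (twin `55696m1`; `N = 55696 = 2⁴·59²`, `d* = -59`, `#Ш_an(E) = 9`) -/
/-- The Frobenius polynomial at `13` of a curve with `#Ẽ(𝔽_{13}) = 8` reduced mod `3`, `X² − (13 + 1 − 8)X + 13`, has no
root in `𝔽₃` (irreducibility witness numeral, x10 GEN 12's shape). [folklore] -/
theorem noroot3_frob_13_8 :
    ∀ t : ZMod 3, t ^ 2 - ((((13 : ℕ) : ℤ) + 1 - (8 : ℕ) : ℤ) : ZMod 3) * t + ((13 : ℕ) : ZMod 3) ≠ 0 := by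
  decide

/-- The local Tamagawa certificate of the self-twist `55696m1` at `2` (`TamLocal` = `⟨2, 1, 5, 0, 158, 1, 512, 24, 72, 7, 4⟩`, additive Kodaira `I*ₙ`, value set `{2,4}`) passes
the kernel check (n1011-p18's glue `vis3_certs.py`, observatory Tate engine, unchanged). [cite: SilvermanATAEC1994, IV.9.4] -/
theorem tamLocal_check_55696m1_2 :
    TamLocal.check ⟨2, 1, 5, 0, 158, 1, 512, 24, 72, 7, 4⟩ ⟨0, 1, 0, 2616, 73844⟩ = true := by
  decide +kernel

/-- The local Tamagawa certificate of the self-twist `55696m1` at `59` (`TamLocal` = `⟨59, 7, 4, 0, 39, 0, 0, 3, 3, 2, 2⟩`, additive type `III`, `c = 2`) passes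
the kernel check (n1011-p18's glue `vis3_certs.py`, observatory Tate engine, unchanged). [cite: SilvermanATAEC1994, IV.9.4] -/
theorem tamLocal_check_55696m1_59 :
    TamLocal.check ⟨59, 7, 4, 0, 39, 0, 0, 3, 3, 2, 2⟩ ⟨0, 1, 0, 2616, 73844⟩ = true := by
  decide +kernel

/-- **SELF-TWIST VISIBILITY RECORD, place `3` FREE (closes nothing, moves no mark): a non-zero `3`-torsion
element of `Ш(E/ℚ)` for `E = 55696l1` from its rank-2 self-twist `E′ = 55696m1 = E ⊗ χ_{-59}`**, both curves
GOOD ORDINARY and ANOMALOUS at `3` (kind (v), `hMR`); the other places of `S` = places over `[2, 3, 59]` are additive for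
`E′` with `E′(ℚ_ℓ)[3] = 0` (kind (i), TamLocal certificates in the kernel: `2` (Kodaira I*ₙ, value set {2,4}), `59` (type III, c = 2)); `E[3]` irreducible from
the Frobenius witness `ℓ = 13` (`#Ẽ(𝔽_{13}) = 8`). Conditional on `hMR` (Mazur–Rubin 2015).
[cite: MazurRubin2015SelmerCompanions, Thm. 3.1 (iv)(b) and §6 proof Case 5] [cite: CremonaMazur2000, §3 and Table 1]
[cite: Mazur1978, §6 Prop. 6.3 (1) (p. 153)] [cite: Cremona2006, Table 1 (labels 55696l1, 55696m1)] -/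
theorem exists_sha_three_selfTwist_v55696l1
    (hMR : selmerLocalKer_iff_of_goodReduction_above)
    (hGZK : rank_eq_analyticRank_of_analyticRank_le_one)
    (W : WeierstrassCurve ℚ) [W.IsElliptic] [W.IsGloballyMinimal]
    (hI : integralModelInt W = ⟨0, 1, 0, 9105136, (-14983896556)⟩) (hr : W.analyticRank = 0)
    (W' : WeierstrassCurve ℚ) (hW' : W' = ⟨0, 1, 0, 2616, 73844⟩) [W'.IsElliptic]
    (θ : geomTorsion W' ((3 : ℕ) : ℤ) ≃+ geomTorsion W ((3 : ℕ) : ℤ))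
    (hθ : ∀ (σ : Field.absoluteGaloisGroup ℚ) (P : geomTorsion W' ((3 : ℕ) : ℤ)), θ (σ • P) = σ • θ P)
    (hrank : 1 ≤ W'.mordellWeilRank) :
    ∃ c : W.sha, c ≠ 0 ∧ 3 • c = 0 := by
  haveI : Fact (Nat.Prime 3) := ⟨Nat.prime_three⟩
  haveI : Fact (Nat.Prime 2) := ⟨by norm_num⟩
  haveI : Fact (Nat.Prime 13) := ⟨by norm_num⟩
  haveI : Fact (Nat.Prime 59) := ⟨by norm_num⟩
  -- the row `55696l1`: `E(ℚ)` finite of order prime to `3`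
  have hfin : Finite W.toAffine.Point := finite_point_of_analyticRank_eq_zero W hGZK hr
  have hirr : W.HasIrreducibleModPGaloisRep 3 :=
    hasIrreducibleModPGaloisRep_of_intModel_of_noroot hI 3 13 (by norm_num) (by decide +kernel)
      Summit.BirchSwinnertonDyer.Rank1Residual.X10.card_t55696l1_13 noroot3_frob_13_8
  have hcop : (Nat.card W.toAffine.Point).Coprime 3 := coprime_natCard_point_of_irr W 3 hirr
  have hE : (⟨0, 1, 0, 9105136, (-14983896556)⟩ : WeierstrassCurve ℤ).map (Int.castRingHom ℚ) = W := by
    rw [IntModelTam.eq_baseChange_of_integralModelInt hI]; rfl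
  -- the partner `55696m1`: globally minimal, integral model
  have hM' : W'.IsGloballyMinimal := by
    rw [hW']
    exact Summit.BirchSwinnertonDyer.Rank1Residual.X10.isGloballyMinimal_of_krausCriterion_bounded₃ 0 1 0 2616 73844
      (by decide +kernel) (by decide +kernel) (by decide +kernel) (by decide +kernel)
  have hI' : integralModelInt W' = ⟨0, 1, 0, 2616, 73844⟩ := by
    subst hW'; exact integralModelInt_eq_of_map_eq _ (map_mk_int 0 1 0 2616 73844)
  have hF : (⟨0, 1, 0, 2616, 73844⟩ : WeierstrassCurve ℤ).map (Int.castRingHom ℚ) = W' := by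
    rw [hW']; exact map_mk_int 0 1 0 2616 73844
  -- prime support of the two discriminants
  have hΔE : ∀ q : ℕ, q.Prime → (q : ℤ) ∣ (⟨0, 1, 0, 9105136, (-14983896556)⟩ : WeierstrassCurve ℤ).Δ → q ∈ [2, 3, 59] :=
    X11b.forall_mem_of_natAbs_eq_prod_pow [2, 3, 59] [24, 0, 9]
      (by intro q hq; simp only [List.mem_cons, List.mem_nil_iff, or_false] at hq; rcases hq with rfl | rfl | rfl <;> norm_num)
      (by decide +kernel)
  have hΔF : ∀ q : ℕ, q.Prime → (q : ℤ) ∣ (⟨0, 1, 0, 2616, 73844⟩ : WeierstrassCurve ℤ).Δ → q ∈ [2, 3, 59] :=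
    X11b.forall_mem_of_natAbs_eq_prod_pow [2, 3, 59] [24, 0, 3]
      (by intro q hq; simp only [List.mem_cons, List.mem_nil_iff, or_false] at hq; rcases hq with rfl | rfl | rfl <;> norm_num)
      (by decide +kernel)
  refine exists_sha_ne_zero_three_of_congr_goodAtThree_of_primeList hMR W W' θ hθ hE hF [2, 3, 59] (by simp) hΔE hΔF
    (by decide +kernel) (by decide +kernel) hfin hcop hrank (fun v hvL hv3 ↦ ?_)
  simp only [List.mem_cons, List.mem_nil_iff, or_false] at hvL
  rcases hvL with h2 | h3 | h59
  · -- `v = 2`: additive Kodaira I*ₙ, value set {2,4}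
    exact LocalTorsionAway.natCard_ker_nsmul_adicCompletion_eq_one_of_intModel_of_additive_tamLocal_forall hI' 2 3
      (by norm_num) h2 (by decide) (by decide) (E := ⟨2, 1, 5, 0, 158, 1, 512, 24, 72, 7, 4⟩) rfl
      tamLocal_check_55696m1_2 (by decide)
  · exact absurd h3 hv3
  · -- `v = 59`: additive type III, `c = 2`
    exact LocalTorsionAway.natCard_ker_nsmul_adicCompletion_eq_one_of_intModel_of_additive hI' 59 3 (by norm_num) h59
      (by decide) (by decide)
      (IntModelTam.localTamagawaNumber_padic_eq_of_intModel_of_tamLocal hI' 59 (E := ⟨59, 7, 4, 0, 39, 0, 0, 3, 3, 2, 2⟩)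
        rfl tamLocal_check_55696m1_59 (c := 2) (by decide)) (by norm_num)

/-- **`3² ∣ #Ш(55696l1)[3^∞]`** from the visible element and the Cassels–Tate parity (`hCT`). Conditional on `hMR`, `hCT`.
[cite: SilvermanAEC2009, Thm. X.4.14] [cite: MazurRubin2015SelmerCompanions, Thm. 3.1 (iv)(b)] -/
theorem sq_dvd_card_sha_three_selfTwist_v55696l1
    (hCT : exists_casselsTate_pairing (K := ℚ))
    (hMR : selmerLocalKer_iff_of_goodReduction_above)
    (hGZK : rank_eq_analyticRank_of_analyticRank_le_one)
    (W : WeierstrassCurve ℚ) [W.IsElliptic] [W.IsGloballyMinimal]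
    (hI : integralModelInt W = ⟨0, 1, 0, 9105136, (-14983896556)⟩) (hr : W.analyticRank = 0)
    (W' : WeierstrassCurve ℚ) (hW' : W' = ⟨0, 1, 0, 2616, 73844⟩) [W'.IsElliptic]
    (θ : geomTorsion W' ((3 : ℕ) : ℤ) ≃+ geomTorsion W ((3 : ℕ) : ℤ))
    (hθ : ∀ (σ : Field.absoluteGaloisGroup ℚ) (P : geomTorsion W' ((3 : ℕ) : ℤ)), θ (σ • P) = σ • θ P)
    (hrank : 1 ≤ W'.mordellWeilRank) :
    3 ^ 2 ∣ Nat.card (AddCommGroup.primaryComponent W.sha 3) := by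
  haveI : Finite W.sha := (hGZK W (by rw [hr]; exact zero_le_one)).2
  exact Visible.sq_dvd_card_sha_three_of_exists_sha_torsion hCT W
    (exists_sha_three_selfTwist_v55696l1 hMR hGZK W hI hr W' hW' θ hθ hrank)

/-- **The typed LOWER binder `MissingLowerBoundAt E 3` for `55696l1`** (`ord₃ #Ш_an ≤ ord₃ #Ш`) from the visible
`3`-torsion element, the Cassels–Tate squareness and the analytic datum `#Ш_an = 9` (`hq`, Cremona `allbsd`;
evidence binder). Conditional on `hMR`, `hCT`. [cite: SilvermanAEC2009, Thm. X.4.14] [cite: Cremona2006, Table 1 (label 55696l1)] -/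
theorem missingLowerBoundAt_three_selfTwist_v55696l1
    (hCT : exists_casselsTate_pairing (K := ℚ))
    (hMR : selmerLocalKer_iff_of_goodReduction_above)
    (hGZK : rank_eq_analyticRank_of_analyticRank_le_one)
    (W : WeierstrassCurve ℚ) [W.IsElliptic] [W.IsGloballyMinimal]
    (hI : integralModelInt W = ⟨0, 1, 0, 9105136, (-14983896556)⟩) (hr : W.analyticRank = 0)
    {q : ℚ} (hq : shaAn W = (q : ℂ)) (hv : padicValRat 3 q ≤ 2)
    (W' : WeierstrassCurve ℚ) (hW' : W' = ⟨0, 1, 0, 2616, 73844⟩) [W'.IsElliptic]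
    (θ : geomTorsion W' ((3 : ℕ) : ℤ) ≃+ geomTorsion W ((3 : ℕ) : ℤ))
    (hθ : ∀ (σ : Field.absoluteGaloisGroup ℚ) (P : geomTorsion W' ((3 : ℕ) : ℤ)), θ (σ • P) = σ • θ P)
    (hrank : 1 ≤ W'.mordellWeilRank) :
    haveI : Fact (Nat.Prime 3) := ⟨Nat.prime_three⟩
    MissingLowerBoundAt W 3 := by
  haveI : Fact (Nat.Prime 3) := ⟨Nat.prime_three⟩
  have hvis := exists_sha_three_selfTwist_v55696l1 hMR hGZK W hI hr W' hW' θ hθ hrank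
  exact missingLowerBoundAt_of_casselsTate_of_pow_dvd W 3 hCT (hGZK W (by rw [hr]; exact zero_le_one)).2 hq
    (k := 1) (by simpa using hv) (by simpa using dvd_shaOrder_of_exists_torsion W 3 hvis)


end Summit.BirchSwinnertonDyer.Rank1Residual.X10.SelfTwist

end
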